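import Literature.NumberTheory.EllipticCurves.CanonicalPAdicHeightSqKExistenceProofs
import Literature.NumberTheory.EllipticCurves.GlobalMinimalModelNumberFieldBaseChangeProofs
import Literature.NumberTheory.EllipticCurves.ComplexMultiplicationTwistIsogenyProofs
import Literature.NumberTheory.EllipticCurves.ComplexMultiplicationLocalFactorsAux
import Literature.NumberTheory.EllipticCurves.Rank1Residual.X11RankOneCertificates.Minimality
import Literature.NumberTheory.EllipticCurves.OrdinaryPrimesProofs
import HarnessLib

/-!
# The canonical `2`-adic height datum (sigma-squared form) on `X₀(49) = 49a1`, over `ℚ` and over the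
# quadratic fields in which `2` splits (`K = ℚ(√−7)`)

Cell `bsd-goldfeld`, typer seat `bsd-goldfeld-ty` (g10), formula axis at `p = 2`; support for item
`stmt-BirchSwinnertonDyer-19141` (`LTYZThm11CMRankOnePPart` = Li–Tian–Yan–Zhu 2025 Thm 1.1, whose
`p = 2` case (ii) is stated for the curve `A = X₀(49)` and its quadratic twists `A^{(D)}`, `D ≡ 1 (mod 4)`,
§1.3 (II) and §3 of the authors' version, and is phrased with the `2`-ADIC REGULATOR `R_2(E/ℚ)`,
`R_2(E/K)`). Theorems only: no definition, no named fact, no instance.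

**What is proved.** The receptacle for every `p = 2` height statement of this cell is
`PAdicHeightData.IsCanonicalSq` / `PAdicHeightDataK.IsCanonicalSq` (`PadicSigmaSq.lean`): the datum whose
quadratic form on admissible points is `log₂ den x(P) − log₂ Σ₂(z(P))`, `Σ₂ = σ²` the squared
Mazur–Tate `2`-adic sigma function (Silverman 2005 §5 Rem. 2 = the tree's printed fact
`mazurTate_sigmaSq_existsUnique_two`). The generic existence-and-uniqueness theorems
`existsUnique_isCanonicalSq_two` (over `ℚ`) and `exists_/existsUnique_isCanonicalSqK_two_of_discr_mod_eight`
(over a quadratic `K` with `d_K ≡ 1 (mod 8)`) ask for a globally minimal `W/ℚ` with GOOD ORDINARY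
reduction at `2`. This file discharges those hypotheses IN THE KERNEL for THE curve of LTYZ Thm 1.1 (ii),
`X₀(49) = 49a1 = cm7 = [1, −1, 0, −2, −1]`, from Literature-side data only (the Summit-side file
`Theorems/GoldfeldGoodTwistsX049.lean` has the same three computations inside the BSD summit's cone,
which a Literature module may not import):

* `cm7_isGloballyMinimal` — `[1, −1, 0, −2, −1]` is a global minimal model (`Δ = −7³`: no prime has
  `q¹² ∣ Δ`; Silverman's criterion `isGloballyMinimal_of_int_criterion`);
* `cm7_integralModelInt`, `cm7_minimalDiscriminantInt` (`Δ_min = −343`), `cm7_reductionPointCount_two`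
  (`#Ẽ(𝔽₂) = 2`), `cm7_frobeniusTrace_two` (`a₂(49a1) = 1`, ODD: `2` is ORDINARY — as it must be, `2`
  splits in `ℚ(√−7)`), `cm7_hasGoodReductionAtPrime` (every `ℓ ≠ 7`), `cm7_hasGoodReductionAtPrime_two`;
* `cm7_exists_isMazurTateSigmaSqPair_two` — under the printed fact, `X₀(49) ⊗ ℚ₂` carries its
  sigma-squared pair;
* **`cm7_existsUnique_isCanonicalSq_two`** — under the printed fact, THE canonical `2`-adic height
  datum of `X₀(49)/ℚ` in sigma-squared form exists and is unique
  (`∃! D : PAdicHeightData cm7 2, D.IsCanonicalSq`);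
* **`cm7_exists_isCanonicalSqK_two_of_discr_mod_eight`** — and over every quadratic field `K` with
  `d_K ≡ 1 (mod 8)` (so `2` splits in `K`; `K = ℚ(√−7)`, `d_K = −7`, is the CM field of `X₀(49)` and the
  field of LTYZ §§3–9) the `K`-datum exists (`∃ DK : PAdicHeightDataK cm7 2 K, DK.IsCanonicalSq`);
  `cm7_existsUnique_isCanonicalSqK_two_of_discr_mod_eight` — uniquely so, granted global minimality of
  `cm7 ⊗ K` (the standing instance hypothesis of `existsUnique_isCanonicalSqK_two`); and (§4, rev. 2)
  **`cm7_existsUnique_isCanonicalSqK_two`** / `cm7_existsUnique_isCanonicalSqK_two_of_discr_eq_neg_seven`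
  — BINDER-FREE uniqueness: `49a1 ⊗ K` IS globally minimal over every quadratic `K`
  (`cm7_baseChange_isGloballyMinimal`, `GlobalMinimalModelNumberFieldBaseChangeProofs`: `Δ = −7³`,
  `[K:ℚ]·3 < 12`), so over `K = ℚ(√−7)` THE `2`-adic `K`-datum of `X₀(49)` exists AND is unique with no
  instance hypothesis left — both global-minimality inputs (over `ℚ` and over `K`) are kernel theorems.

So the `p = 2` statements of this cell typed over `IsCanonicalSq` (planned rows R2–R5 of
`HOME/TY-HYPOTHESES-AT-TWO.md` §10.4) are NON-VACUOUS on the very object of LTYZ Thm 1.1 (ii), with the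
one printed input `mazurTate_sigmaSq_existsUnique_two` kept as an explicit binder `hMT` (never
discharged silently) and global minimality supplied by a kernel theorem (referee watch 11 of
`REF-P2-AUDIT-G46.md`).

HONEST FRAMING. Nothing here identifies the sigma-squared datum with the Schneider / Mazur–Tate (1983)
canonical height at `p = 2` — that identification (Mazur–Tate 1991 §§3–4; Wuthrich 2004 §2) is
cite-only in the store (acq-00745 / acq-00916 / acq-01927) and is NOT asserted; see the memo §11.3. BSD
is not advanced by this file; it is kernel bookkeeping for the `p = 2` height receptacle.

References: J. H. Silverman, *p-adic properties of division polynomials and elliptic divisibility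
sequences*, Math. Ann. 332 (2005), §5 Thm. 11 and Rem. 2 [Silverman2005DivPoly]; B. Mazur, W. Stein,
J. Tate, *Computation of p-adic heights and log convergence*, Doc. Math. Extra Vol. Coates (2006), §1,
§2.7–2.8 [MazurSteinTate2006]; Y. Li, Y. Tian, X. Yan, X. Zhu, PAMQ 21 (2025), Thm 1.1, §1.3 (II), §3
[LiTianYanZhu2025]; J. E. Cremona, *Algorithms for Modular Elliptic Curves* (1997), Table 1, curve 49a1
[Cremona1997]; J. H. Silverman, *AEC* (2009) VII.1 Rem. 1.1 [SilvermanAEC2009]; D. A. Marcus,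
*Number Fields*, Ch. 3 Thm. 25 [Marcus2018].
-/

set_option autoImplicit false

noncomputable section

open scoped Classical

open WeierstrassCurve

namespace Literature.NumberTheory.EllipticCurves

/-! ## §1. `49a1 = cm7 = [1, −1, 0, −2, −1]` at the prime `2`, in Literature currency -/

section X049AtTwo

/-- **`49a1 = [1, −1, 0, −2, −1]` is a global minimal model**: `Δ = −343 = −7³`, so no prime `q` has
`q¹² ∣ Δ` (Silverman's sufficient criterion, *AEC* VII.1 Rem. 1.1 at every place; tree
`isGloballyMinimal_of_int_criterion`). A THEOREM, not an instance (use `haveI`).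
[cite: Cremona1997, Table 1 (curve 49a1)] [cite: SilvermanAEC2009, VII.1 Remark 1.1] -/
theorem cm7_isGloballyMinimal : cm7.IsGloballyMinimal :=
  Rank1Residual.X11RankOneCertificates.isGloballyMinimal_of_int_criterion 1 (-1) 0 (-2) (-1)
    fun q hq ⟨hΔ, _⟩ => by
      have hD : Rank1Residual.X11RankOneCertificates.discOf [1, -1, 0, -2, -1] = -343 := by
        decide +kernel
      rw [hD, dvd_neg] at hΔ
      have h1 : q ^ 12 ∣ 343 := by exact_mod_cast Int.natAbs_dvd_natAbs.mpr hΔ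
      have h2 : q ^ 12 ≤ 343 := Nat.le_of_dvd (by norm_num) h1
      have h3 : 2 ^ 12 ≤ q ^ 12 := Nat.pow_le_pow_left hq.two_le 12
      omega

/-- The integral model of `49a1` is the integer equation `[1, −1, 0, −2, −1]` (uniqueness of lifts along
`ℤ ↪ ℚ`, Silverman *AEC* VIII.8). [cite: Cremona1997, Table 1 (curve 49a1 = [1, −1, 0, −2, −1])] -/
theorem cm7_integralModelInt :
    haveI := cm7_isGloballyMinimal
    integralModelInt cm7 = ⟨1, -1, 0, -2, -1⟩ := by
  haveI := cm7_isGloballyMinimal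
  apply WeierstrassCurve.map_injective (f := Int.castRingHom ℚ) Int.cast_injective
  show (integralModelInt cm7).map (Int.castRingHom ℚ) =
    (⟨1, -1, 0, -2, -1⟩ : WeierstrassCurve ℤ).map (Int.castRingHom ℚ)
  rw [map_integralModelInt]
  ext <;> simp [WeierstrassCurve.map]

/-- `Δ_min(49a1) = −343 = −7³`. [cite: Cremona1997, Table 1 (curve 49a1)] -/
theorem cm7_minimalDiscriminantInt :
    haveI := cm7_isGloballyMinimal
    minimalDiscriminantInt cm7 = -343 := by
  haveI := cm7_isGloballyMinimal
  show minimalDiscriminantInt cm7 = -343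
  rw [minimalDiscriminantInt, cm7_integralModelInt]
  simp only [WeierstrassCurve.Δ, WeierstrassCurve.b₂, WeierstrassCurve.b₄, WeierstrassCurve.b₆,
    WeierstrassCurve.b₈]
  norm_num

/-- The reduction of `[1, −1, 0, −2, −1]` modulo `2` is `y² + xy = x³ + x² + 1` over `𝔽₂` (plumbing).
[folklore] -/
private theorem cm7_int_map_zmod_two :
    (⟨1, -1, 0, -2, -1⟩ : WeierstrassCurve ℤ).map (Int.castRingHom (ZMod 2)) = ⟨1, 1, 0, 0, 0 + 1⟩ := by
  ext <;> decide

/-- **`#Ẽ(𝔽₂) = 2` for `49a1`** (the points `O` and `(0, 1)` of `y² + xy = x³ + x² + 1`; kernel count via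
the tree's `natCard_point_F2_two`). [cite: Cremona1997, Table 1 (curve 49a1)] -/
theorem cm7_reductionPointCount_two :
    haveI := cm7_isGloballyMinimal
    cm7.reductionPointCount 2 = 2 := by
  haveI := cm7_isGloballyMinimal
  show cm7.reductionPointCount 2 = 2
  rw [reductionPointCount, cm7_integralModelInt, cm7_int_map_zmod_two]
  exact natCard_point_F2_two 0

/-- **`a₂(49a1) = 2 + 1 − #Ẽ(𝔽₂) = 1`.** [cite: Cremona1997, Table 1 (curve 49a1)] -/
theorem cm7_frobeniusTrace_two :
    haveI := cm7_isGloballyMinimal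
    cm7.frobeniusTrace 2 = 1 := by
  haveI := cm7_isGloballyMinimal
  show cm7.frobeniusTrace 2 = 1
  rw [frobeniusTrace, cm7_reductionPointCount_two]
  norm_num

/-- **`2` is ORDINARY for `49a1`**: `a₂ = 1` is odd (as it must be: `2` splits in the CM field `ℚ(√−7)`,
`−7 ≡ 1 (mod 8)`). [cite: Cremona1997, Table 1 (curve 49a1)] -/
theorem cm7_not_two_dvd_frobeniusTrace_two :
    haveI := cm7_isGloballyMinimal
    ¬ (2 : ℤ) ∣ cm7.frobeniusTrace 2 := by
  haveI := cm7_isGloballyMinimal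
  show ¬ (2 : ℤ) ∣ cm7.frobeniusTrace 2
  rw [cm7_frobeniusTrace_two]
  decide

/-- **`49a1` has good reduction at every prime `ℓ ≠ 7`** (`Δ_min = −7³`; Silverman *AEC* VII.1 Rem. 1.1 via
the tree's `hasGoodReductionAtPrime_of_not_dvd`). [cite: Cremona1997, Table 1 (curve 49a1: N = 49)] -/
theorem cm7_hasGoodReductionAtPrime (ℓ : ℕ) [hℓ : Fact ℓ.Prime] (h7 : ℓ ≠ 7) :
    haveI := cm7_isGloballyMinimal
    cm7.HasGoodReductionAtPrime ℓ := by
  haveI := cm7_isGloballyMinimal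
  show cm7.HasGoodReductionAtPrime ℓ
  refine hasGoodReductionAtPrime_of_not_dvd cm7 ℓ ?_
  rw [cm7_minimalDiscriminantInt, dvd_neg, show (343 : ℤ) = 7 ^ 3 by norm_num]
  intro h
  have h' : (ℓ : ℤ) ∣ 7 := (Nat.prime_iff_prime_int.mp hℓ.out).dvd_of_dvd_pow h
  have h'' : ℓ ∣ 7 := by exact_mod_cast h'
  exact h7 ((Nat.prime_dvd_prime_iff_eq hℓ.out (by norm_num)).mp h'')

/-- **`49a1` has good reduction at `2`** (`2 ∤ Δ_min = −343`). [cite: Cremona1997, Table 1 (curve 49a1)] -/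
theorem cm7_hasGoodReductionAtPrime_two :
    haveI := cm7_isGloballyMinimal
    cm7.HasGoodReductionAtPrime 2 :=
  cm7_hasGoodReductionAtPrime 2 (by decide)

end X049AtTwo

/-! ## §2. The canonical `2`-adic height datum of `X₀(49)/ℚ`, sigma-squared form -/

section RatSide

/-- **`X₀(49) ⊗ ℚ₂` carries its sigma-squared pair** (the square `σ² ∈ z² + z³ℤ₂⟦z⟧` of the Mazur–Tate
`2`-adic sigma function together with its constant): `49a1` is globally minimal with good ordinary
reduction at `2`, so the printed fact `mazurTate_sigmaSq_existsUnique_two` (Silverman 2005 §5 Rem. 2,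
binder `hMT`) applies through the tree's `exists_isMazurTateSigmaSqPair_two`.
[cite: Silverman2005DivPoly, §5 Rem. 2] -/
theorem cm7_exists_isMazurTateSigmaSqPair_two (hMT : mazurTate_sigmaSq_existsUnique_two) :
    ∃ Sq : PowerSeries ℚ_[2], ∃ c : ℚ_[2], (cm7.baseChange ℚ_[2]).IsMazurTateSigmaSqPair Sq c := by
  haveI := cm7_isGloballyMinimal
  exact cm7.exists_isMazurTateSigmaSqPair_two hMT cm7_hasGoodReductionAtPrime_two
    cm7_not_two_dvd_frobeniusTrace_two

/-- **THE canonical `2`-adic height datum of `X₀(49)/ℚ` exists, sigma-squared form**: under the printed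
fact `mazurTate_sigmaSq_existsUnique_two` there is a symmetric bilinear torsion-vanishing pairing
`X₀(49)(ℚ) × X₀(49)(ℚ) → ℚ₂` whose quadratic form on admissible points is `log₂ den x(P) − log₂ Σ₂(z(P))`
(the tree's `exists_isCanonicalSq_two` at `W = 49a1`, its hypotheses discharged by §1). (`X₀(49)(ℚ) ≅ ℤ/2`
is finite, so the datum is in fact the zero pairing; the content of this instance is that the
receptacle's hypotheses hold on the curve of LTYZ Thm 1.1 (ii) — the same three kernel facts serve its
twists of positive rank, see the module docstring.) [cite: Silverman2005DivPoly, §5 Rem. 2]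
[cite: MazurSteinTate2006, §2.7] -/
theorem cm7_exists_isCanonicalSq_two (hMT : mazurTate_sigmaSq_existsUnique_two) :
    ∃ D : PAdicHeightData cm7 2, D.IsCanonicalSq := by
  haveI := cm7_isGloballyMinimal
  exact cm7.exists_isCanonicalSq_two hMT cm7_hasGoodReductionAtPrime_two cm7_not_two_dvd_frobeniusTrace_two

/-- **… and it is unique** (`existsUnique_isCanonicalSq_two` at `W = 49a1`).
[cite: Silverman2005DivPoly, §5 Rem. 2] [cite: MazurSteinTate2006, §2.7] -/
theorem cm7_existsUnique_isCanonicalSq_two (hMT : mazurTate_sigmaSq_existsUnique_two) :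
    ∃! D : PAdicHeightData cm7 2, D.IsCanonicalSq := by
  haveI := cm7_isGloballyMinimal
  exact cm7.existsUnique_isCanonicalSq_two hMT cm7_hasGoodReductionAtPrime_two
    cm7_not_two_dvd_frobeniusTrace_two

end RatSide

/-! ## §3. Over a quadratic field in which `2` splits (`K = ℚ(√−7)`, `d_K = −7 ≡ 1 (mod 8)`) -/

section KSide

/-- **THE canonical `2`-adic height datum of `X₀(49)` over a quadratic field `K` with `d_K ≡ 1 (mod 8)`
exists, sigma-squared form** — in particular over the CM field `K = ℚ(√−7)` (`d_K = −7`), the field of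
LTYZ §§3–9: `2` splits in `K` (`#(K →+* ℚ₂) = 2`, the tree's `card_ringHom_padic_two_of_discr_mod_eight`,
Marcus Ch. 3 Thm. 25), and `49a1` is globally minimal with good ordinary reduction at `2` (§1), so the tree's
`exists_isCanonicalSqK_two_of_discr_mod_eight` applies under the printed fact (binder `hMT`): there is a
symmetric bilinear torsion-vanishing pairing on `X₀(49)(K)` whose quadratic form on `K`-admissible points is
`log₂ N𝔡(x(P)) − Σ_ι log₂ Σ₂(z(ιP))`. [cite: Silverman2005DivPoly, §5 Rem. 2] [cite: MazurSteinTate2006, §2.8]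
[cite: Marcus2018, Ch. 3 Thm. 25] -/
theorem cm7_exists_isCanonicalSqK_two_of_discr_mod_eight (hMT : mazurTate_sigmaSq_existsUnique_two)
    (K : Type) [Field K] [NumberField K] (h2 : Module.finrank ℚ K = 2)
    (h8 : NumberField.discr K % 8 = 1) :
    ∃ DK : PAdicHeightDataK cm7 2 K, DK.IsCanonicalSq := by
  haveI := cm7_isGloballyMinimal
  exact cm7.exists_isCanonicalSqK_two_of_discr_mod_eight hMT K h2 h8 cm7_hasGoodReductionAtPrime_two
    cm7_not_two_dvd_frobeniusTrace_two

/-- **… and it is unique** when `49a1 ⊗ K` is globally minimal (the standing instance hypothesis of the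
tree's `existsUnique_isCanonicalSqK_two`; for `K = ℚ(√−7)` it holds since `c₄(49a1) = 105` is squarefree,
so `ord_w c₄ ≤ 2 < 4` at every place `w` of `K` — not derived here).
[cite: Silverman2005DivPoly, §5 Rem. 2] [cite: MazurSteinTate2006, §2.8] [cite: Marcus2018, Ch. 3 Thm. 25] -/
theorem cm7_existsUnique_isCanonicalSqK_two_of_discr_mod_eight
    (hMT : mazurTate_sigmaSq_existsUnique_two) (K : Type) [Field K] [NumberField K]
    [(cm7.baseChange K).IsGloballyMinimal] (h2 : Module.finrank ℚ K = 2)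
    (h8 : NumberField.discr K % 8 = 1) :
    ∃! DK : PAdicHeightDataK cm7 2 K, DK.IsCanonicalSq := by
  haveI := cm7_isGloballyMinimal
  exact cm7.existsUnique_isCanonicalSqK_two_of_discr_mod_eight hMT K h2 h8
    cm7_hasGoodReductionAtPrime_two cm7_not_two_dvd_frobeniusTrace_two

/-- The discriminant form of the hypothesis (plumbing): a quadratic field with `d_K = −7` (i.e.
`K ≅ ℚ(√−7)`) has `d_K % 8 = 1` under Lean's Euclidean `%`. [folklore] -/
private theorem discr_mod_eight_of_discr_eq_neg_seven (K : Type) [Field K] [NumberField K]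
    (h7 : NumberField.discr K = -7) : NumberField.discr K % 8 = 1 := by
  rw [h7]; decide

/-- **Over `K` with `d_K = −7`** (the CM field `ℚ(√−7)` of `X₀(49)`): the `2`-adic `K`-datum of `X₀(49)`
exists, sigma-squared form. [cite: Silverman2005DivPoly, §5 Rem. 2] [cite: MazurSteinTate2006, §2.8] -/
theorem cm7_exists_isCanonicalSqK_two_of_discr_eq_neg_seven (hMT : mazurTate_sigmaSq_existsUnique_two)
    (K : Type) [Field K] [NumberField K] (h2 : Module.finrank ℚ K = 2)
    (h7 : NumberField.discr K = -7) :
    ∃ DK : PAdicHeightDataK cm7 2 K, DK.IsCanonicalSq :=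
  cm7_exists_isCanonicalSqK_two_of_discr_mod_eight hMT K h2 (discr_mod_eight_of_discr_eq_neg_seven K h7)

end KSide

/-! ## §4. Binder-free uniqueness over quadratic `K` (rev. 2): `49a1 ⊗ K` is globally minimal -/

section KSideUnique

/-- **THE canonical `2`-adic `K`-datum of `X₀(49)` over a quadratic field with `d_K ≡ 1 (mod 8)` exists
AND IS UNIQUE — no instance hypothesis**: `49a1 ⊗ K` is globally minimal over every quadratic `K`
(`cm7_baseChange_isGloballyMinimal`: `Δ(49a1) = −7³`, `q⁴ ∤ Δ`, `[K : ℚ]·3 < 12`; Silverman VII.1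
Rem. 1.1 / VIII.8), which discharges the standing binder of
`cm7_existsUnique_isCanonicalSqK_two_of_discr_mod_eight`. The printed input
`mazurTate_sigmaSq_existsUnique_two` stays the explicit binder `hMT`.
[cite: Silverman2005DivPoly, §5 Rem. 2] [cite: MazurSteinTate2006, §2.8] [cite: Marcus2018, Ch. 3 Thm. 25]
[cite: SilvermanAEC2009, VII.1 Remark 1.1 and VIII.8] -/
theorem cm7_existsUnique_isCanonicalSqK_two (hMT : mazurTate_sigmaSq_existsUnique_two)
    (K : Type) [Field K] [NumberField K] (h2 : Module.finrank ℚ K = 2)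
    (h8 : NumberField.discr K % 8 = 1) :
    ∃! DK : PAdicHeightDataK cm7 2 K, DK.IsCanonicalSq := by
  haveI := cm7_baseChange_isGloballyMinimal K (by omega)
  exact cm7_existsUnique_isCanonicalSqK_two_of_discr_mod_eight hMT K h2 h8

/-- **Over `K` with `d_K = −7`** (the CM field `ℚ(√−7)` of `X₀(49)`, the field of LTYZ §§3–9): the
`2`-adic `K`-datum of `X₀(49)`, sigma-squared form, exists and is unique (binder-free but for `hMT`).
[cite: Silverman2005DivPoly, §5 Rem. 2] [cite: MazurSteinTate2006, §2.8]
[cite: SilvermanAEC2009, VII.1 Remark 1.1 and VIII.8] -/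
theorem cm7_existsUnique_isCanonicalSqK_two_of_discr_eq_neg_seven
    (hMT : mazurTate_sigmaSq_existsUnique_two) (K : Type) [Field K] [NumberField K]
    (h2 : Module.finrank ℚ K = 2) (h7 : NumberField.discr K = -7) :
    ∃! DK : PAdicHeightDataK cm7 2 K, DK.IsCanonicalSq :=
  cm7_existsUnique_isCanonicalSqK_two hMT K h2 (discr_mod_eight_of_discr_eq_neg_seven K h7)

end KSideUnique

end Literature.NumberTheory.EllipticCurves

end
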